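import Literature.Topology.FourManifolds.SimplifiedBrokenLefschetzRoundHessian
import Literature.Topology.FourManifolds.FibrewiseMorseFramePeriodic
import Literature.Topology.FourManifolds.FibrewiseMorseFrame
import Literature.Topology.FourManifolds.FibredLocalInverse
import Literature.Topology.FourManifolds.PlanarLefschetzBodyJordan
import HarnessLib

/-!
# The Morse–Bott tube of the round circle of a simplified broken Lefschetz fibration

Topic `Literature/Topology/FourManifolds`; the assembly (brick F6 of the fact seat's plan) of the
Morse–Bott tube of the round circle used in the proof of
`nonempty_diffeomorph_sphere_four_of_sblf_genus_one_noLefschetz`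
(`SimplifiedBrokenLefschetzFibration.lean`; Baykur–Kamada 2015, §2 (arXiv p. 7) and §5 ¶1: the
round singularity is *"the fibrewise attachment of a round `1`-handle"* to the lower side).
Everything here is **proved**; there are no definitions and no named facts.

Let `f : X → S²` be a Lefschetz-free SBLF on a closed oriented 4-manifold with equatorial round
image, `v = (0, 0, σ)` the pole of its higher side, `e : S¹ ↪ X` the longitude parametrisation
of the round locus (`f (e u) = (u₀, u₁, 0)`), `ν : S¹ × ℝ³ ↪ X` a tubular neighbourhood of `e`
adapted to the longitude (`exists_circleNbhd_longitude`), and `g (t, x) = σ (f (ν (circlePt t,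
x)))₂` the signed vertical height along the tube, a `1`-periodic family on `ℝ × ℝ³` with
Morse–Bott critical zero section of transverse index `1` (`roundHessian`).

* `RoundTube.injective_mfderiv_lift` — the lift `ν̃ (t, x) = ν (circlePt t, x)` has injective
  differential.
* `IsSimplifiedBrokenLefschetzFibration.exists_morseBott_tube` — **the Morse–Bott tube.**  If
  the transverse Hessian of `g` is time-orientable along the circle — there is a continuous
  `1`-periodic `w : ℝ → ℝ³` with `D²g (t, 0) ((0, w t), (0, w t)) < 0` — then there are `ρ > 0`
  and `Ψ : ℝ × ℝ³ → X`, `C^∞` and a local diffeomorphism on the tube `ℝ × B(0, ρ)`,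
  `1`-periodic in `t`, injective on `[0, 1) × B(0, ρ)`, with `Ψ (t, 0) = e (circlePt t)`,
  **`σ (f (Ψ (t, y)))₂ = -y₀² + y₁² + y₂²`** and the horizontal part of `f (Ψ (t, y))` a positive
  multiple of `circlePt t`, for all `t` and `‖y‖ < ρ`: Morse–Bott coordinates in which the
  vertical height is the standard fibrewise quadratic form of index `1` and the pages
  `{t = const}` lie in the longitude fibres of `f` (Banyaga–Hurtubise 2004, Thm. 2, for the
  nondegenerate critical circle; assembled from the tree's `roundHessian`,
  `Splitting.exists_periodic_adaptedFrame_of_timelike` (`FibrewiseMorseFramePeriodic.lean`),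
  `Splitting.exists_periodic_fibrewiseMorseCoords_of_frame` (`FibrewiseMorseFrame.lean`) and
  `Splitting.exists_fibred_localInverse` (`FibredLocalInverse.lean`)).  The time-orientability
  hypothesis is necessary for a `1`-periodic normal form (a twisted round handle has none) and
  holds for the round circle of an SBLF by the triviality of its monodromy along the circle on
  the lower side; it is discharged where the tube is used.

## References

* R. İ. Baykur, S. Kamada, *Classification of broken Lefschetz fibrations with small fiber
  genera*, J. Math. Soc. Japan 67 (2015), §2, §5. [BaykurKamada2015]
* A. Banyaga, D. E. Hurtubise, *A proof of the Morse–Bott Lemma*, Expo. Math. 22 (2004),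
  Thm. 2. [BanyagaHurtubise2004]
* M. W. Hirsch, *Differential Topology*, GTM 33 (1976), Ch. 4 §5, Ch. 6 §1. [HirschDT1976]
-/

noncomputable section

open scoped Manifold ContDiff Topology Real RealInnerProductSpace
open Set Function Filter Metric Module

namespace Literature.Topology.FourManifolds

universe u

namespace RoundTube

/-- A `C^∞` map `ℝ × F → ℝ × F` (vector-space sense) is `C^∞` for the product models on both
sides. [folklore] -/
theorem contMDiffAt_prod_prod_of_contDiffAt {F : Type*} [NormedAddCommGroup F] [NormedSpace ℝ F]
    {Θ : ℝ × F → ℝ × F} {q : ℝ × F} {n : WithTop ℕ∞} (hΘ : ContDiffAt ℝ n Θ q) :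
    ContMDiffAt (𝓘(ℝ, ℝ).prod 𝓘(ℝ, F)) (𝓘(ℝ, ℝ).prod 𝓘(ℝ, F)) n Θ q := by
  have h := contMDiffAt_iff_contDiffAt.2 hΘ
  rw [modelWithCornersSelf_prod, ← chartedSpaceSelf_prod] at h
  exact h

/-- **The lift `ν̃ (t, x) = ν (circlePt t, x)` of a tubular neighbourhood of a circle in a
4-manifold has injective differential** (`ν` is a local diffeomorphism and `circlePt` a local
diffeomorphism onto `S¹`). [folklore] -/
theorem injective_mfderiv_lift {X : Type u} [TopologicalSpace X]
    [ChartedSpace (EuclideanSpace ℝ (Fin 4)) X] [IsManifold (𝓡 4) ∞ X]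
    {c : Metric.sphere (0 : EuclideanSpace ℝ (Fin 2)) 1 → X} (ν : CircleNbhd (𝓡 4) c)
    (p : ℝ × EuclideanSpace ℝ (Fin 3)) :
    Injective (mfderiv (𝓘(ℝ, ℝ).prod 𝓘(ℝ, EuclideanSpace ℝ (Fin 3))) (𝓡 4)
      (fun q : ℝ × EuclideanSpace ℝ (Fin 3) => ν.toFun (circlePt q.1, q.2)) p) := by
  have hνinj : Injective (mfderiv ((𝓡 1).prod 𝓘(ℝ, EuclideanSpace ℝ (Fin 3))) (𝓡 4) ν.toFun
      (circlePt p.1, p.2)) :=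
    ((ν.isLocalDiffeomorph (circlePt p.1, p.2)).mfderivToContinuousLinearEquiv (by simp)).injective
  have hPd : MDifferentiableAt (𝓘(ℝ, ℝ).prod 𝓘(ℝ, EuclideanSpace ℝ (Fin 3)))
      ((𝓡 1).prod 𝓘(ℝ, EuclideanSpace ℝ (Fin 3)))
      (Prod.map circlePt (id : EuclideanSpace ℝ (Fin 3) → EuclideanSpace ℝ (Fin 3))) p :=
    (contMDiff_circlePt.contMDiffAt.mdifferentiableAt (by simp)).prodMap mdifferentiableAt_id
  have hPinj : Injective (mfderiv (𝓘(ℝ, ℝ).prod 𝓘(ℝ, EuclideanSpace ℝ (Fin 3)))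
      ((𝓡 1).prod 𝓘(ℝ, EuclideanSpace ℝ (Fin 3)))
      (Prod.map circlePt (id : EuclideanSpace ℝ (Fin 3) → EuclideanSpace ℝ (Fin 3))) p) := by
    obtain ⟨ang, hang, hsec⟩ := exists_local_section_circlePt p.1
    have hL : MDifferentiableAt ((𝓡 1).prod 𝓘(ℝ, EuclideanSpace ℝ (Fin 3)))
        (𝓘(ℝ, ℝ).prod 𝓘(ℝ, EuclideanSpace ℝ (Fin 3)))
        (Prod.map ang (id : EuclideanSpace ℝ (Fin 3) → EuclideanSpace ℝ (Fin 3)))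
        (Prod.map circlePt (id : EuclideanSpace ℝ (Fin 3) → EuclideanSpace ℝ (Fin 3)) p) :=
      (hang.mdifferentiableAt (by simp)).prodMap mdifferentiableAt_id
    have hcomp := mfderiv_comp p hL hPd
    have hev : (Prod.map ang (id : EuclideanSpace ℝ (Fin 3) → EuclideanSpace ℝ (Fin 3)) ∘
        Prod.map circlePt (id : EuclideanSpace ℝ (Fin 3) → EuclideanSpace ℝ (Fin 3))) =ᶠ[𝓝 p]
        id := by
      have h1 : ∀ᶠ q : ℝ × EuclideanSpace ℝ (Fin 3) in 𝓝 p, ang (circlePt q.1) = q.1 :=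
        (continuousAt_fst (p := p)).eventually hsec
      filter_upwards [h1] with q hq
      show (ang (circlePt q.1), id q.2) = q
      rw [hq]
      rfl
    have hid : mfderiv (𝓘(ℝ, ℝ).prod 𝓘(ℝ, EuclideanSpace ℝ (Fin 3)))
        (𝓘(ℝ, ℝ).prod 𝓘(ℝ, EuclideanSpace ℝ (Fin 3)))
        (Prod.map ang (id : EuclideanSpace ℝ (Fin 3) → EuclideanSpace ℝ (Fin 3)) ∘
          Prod.map circlePt (id : EuclideanSpace ℝ (Fin 3) → EuclideanSpace ℝ (Fin 3))) p =
        mfderiv (𝓘(ℝ, ℝ).prod 𝓘(ℝ, EuclideanSpace ℝ (Fin 3)))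
          (𝓘(ℝ, ℝ).prod 𝓘(ℝ, EuclideanSpace ℝ (Fin 3))) id p := hev.mfderiv_eq
    rw [mfderiv_id, hcomp] at hid
    intro a b hab
    have h2 := congrArg (mfderiv ((𝓡 1).prod 𝓘(ℝ, EuclideanSpace ℝ (Fin 3)))
      (𝓘(ℝ, ℝ).prod 𝓘(ℝ, EuclideanSpace ℝ (Fin 3)))
      (Prod.map ang (id : EuclideanSpace ℝ (Fin 3) → EuclideanSpace ℝ (Fin 3)))
      (Prod.map circlePt (id : EuclideanSpace ℝ (Fin 3) → EuclideanSpace ℝ (Fin 3)) p)) hab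
    rw [← ContinuousLinearMap.comp_apply, ← ContinuousLinearMap.comp_apply, hid] at h2
    exact h2
  have hgd : MDifferentiableAt ((𝓡 1).prod 𝓘(ℝ, EuclideanSpace ℝ (Fin 3))) (𝓡 4) ν.toFun
      (Prod.map circlePt (id : EuclideanSpace ℝ (Fin 3) → EuclideanSpace ℝ (Fin 3)) p) :=
    (ν.isSmoothEmbedding.contMDiff _).mdifferentiableAt (by simp)
  have hcomp' := mfderiv_comp p hgd hPd
  have hfun : (fun q : ℝ × EuclideanSpace ℝ (Fin 3) => ν.toFun (circlePt q.1, q.2)) =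
      ν.toFun ∘ Prod.map circlePt (id : EuclideanSpace ℝ (Fin 3) → EuclideanSpace ℝ (Fin 3)) :=
    rfl
  rw [hfun, hcomp']
  exact hνinj.comp hPinj

end RoundTube


namespace IsSimplifiedBrokenLefschetzFibration

variable {X : Type u} [TopologicalSpace X] [ChartedSpace (EuclideanSpace ℝ (Fin 4)) X]
  [IsManifold (𝓡 4) ∞ X] {o : SmoothOrientation (𝓡 4) X}
  {f : X → (Metric.sphere (0 : EuclideanSpace ℝ (Fin 3)) 1)} {h : ℕ}

/-- **The Morse–Bott tube of the round circle of a Lefschetz-free SBLF** (see the module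
docstring). [cite: BaykurKamada2015, §2 (arXiv p. 7), §5] [cite: BanyagaHurtubise2004, Thm. 2]
[cite: HirschDT1976, Ch. 4 §5, Ch. 6 §1] -/
theorem exists_morseBott_tube [T2Space X] [SecondCountableTopology X] [CompactSpace X]
    (hf : IsSimplifiedBrokenLefschetzFibration o f ∅ h)
    (hround : f '' ({p : X | ¬ Surjective (mfderiv (𝓡 4) (𝓡 2) f p)} \
      (↑(∅ : Finset X) : Set X)) = sphereEquator 1)
    {v : Metric.sphere (0 : EuclideanSpace ℝ (Fin 3)) 1}
    (hv0 : (v : EuclideanSpace ℝ (Fin 3)) 0 = 0) (hv1 : (v : EuclideanSpace ℝ (Fin 3)) 1 = 0)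
    (hlo : ∀ y : (Metric.sphere (0 : EuclideanSpace ℝ (Fin 3)) 1),
      ⟪(y : EuclideanSpace ℝ (Fin 3)), (v : EuclideanSpace ℝ (Fin 3))⟫ < 0 →
        (∀ q, f q = y → Surjective (mfderiv (𝓡 4) (𝓡 2) f q)) ∧
        Nonempty ((Fin (2 * h) → ℤ) ≃ₗ[ℤ]
          Literature.AlgebraicTopology.SingularHomology.singularHomology ℤ ℤ ↥(f ⁻¹' {y}) 1))
    (hhi : ∀ y : (Metric.sphere (0 : EuclideanSpace ℝ (Fin 3)) 1),
      ⟪(y : EuclideanSpace ℝ (Fin 3)),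
          ((-v : (Metric.sphere (0 : EuclideanSpace ℝ (Fin 3)) 1)) : EuclideanSpace ℝ (Fin 3))⟫
          < 0 →
        (∀ q, f q = y → Surjective (mfderiv (𝓡 4) (𝓡 2) f q)) ∧
        Nonempty ((Fin (2 * (h + 1)) → ℤ) ≃ₗ[ℤ]
          Literature.AlgebraicTopology.SingularHomology.singularHomology ℤ ℤ ↥(f ⁻¹' {y}) 1))
    {e : Metric.sphere (0 : EuclideanSpace ℝ (Fin 2)) 1 → X}
    (hrange : range e = {p : X | ¬ Surjective (mfderiv (𝓡 4) (𝓡 2) f p)} \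
      (↑(∅ : Finset X) : Set X))
    (hfe : ∀ u, f (e u) = sphereInclusion 1 2 one_le_two u) (ν : CircleNbhd (𝓡 4) e)
    (hlong : ∀ (u : Metric.sphere (0 : EuclideanSpace ℝ (Fin 2)) 1) (x : EuclideanSpace ℝ (Fin 3)),
      (f (ν.toFun (u, x)) : EuclideanSpace ℝ (Fin 3)) 0 =
          √((f (ν.toFun (u, x)) : EuclideanSpace ℝ (Fin 3)) 0 ^ 2 +
              (f (ν.toFun (u, x)) : EuclideanSpace ℝ (Fin 3)) 1 ^ 2) *
            (u : EuclideanSpace ℝ (Fin 2)) 0 ∧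
        (f (ν.toFun (u, x)) : EuclideanSpace ℝ (Fin 3)) 1 =
          √((f (ν.toFun (u, x)) : EuclideanSpace ℝ (Fin 3)) 0 ^ 2 +
              (f (ν.toFun (u, x)) : EuclideanSpace ℝ (Fin 3)) 1 ^ 2) *
            (u : EuclideanSpace ℝ (Fin 2)) 1 ∧
        0 < (f (ν.toFun (u, x)) : EuclideanSpace ℝ (Fin 3)) 0 ^ 2 +
          (f (ν.toFun (u, x)) : EuclideanSpace ℝ (Fin 3)) 1 ^ 2)
    {g : ℝ × EuclideanSpace ℝ (Fin 3) → ℝ}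
    (hg : ∀ q, g q = (v : EuclideanSpace ℝ (Fin 3)) 2 *
      (f (ν.toFun (circlePt q.1, q.2)) : EuclideanSpace ℝ (Fin 3)) 2)
    {w : ℝ → EuclideanSpace ℝ (Fin 3)} (hw : Continuous w) (hwT : ∀ t, w (t + 1) = w t)
    (hwneg : ∀ t, fderiv ℝ (fderiv ℝ g) (t, 0) ((0 : ℝ), w t) ((0 : ℝ), w t) < 0) :
    ∃ (Ψ : ℝ × EuclideanSpace ℝ (Fin 3) → X) (ρ : ℝ), 0 < ρ ∧
      ContMDiffOn (𝓘(ℝ, ℝ).prod 𝓘(ℝ, EuclideanSpace ℝ (Fin 3))) (𝓡 4) ∞ Ψ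
        ((univ : Set ℝ) ×ˢ ball (0 : EuclideanSpace ℝ (Fin 3)) ρ) ∧
      (∀ q ∈ (univ : Set ℝ) ×ˢ ball (0 : EuclideanSpace ℝ (Fin 3)) ρ,
        IsLocalDiffeomorphAt (𝓘(ℝ, ℝ).prod 𝓘(ℝ, EuclideanSpace ℝ (Fin 3))) (𝓡 4) ∞ Ψ q) ∧
      (∀ (t : ℝ) (y : EuclideanSpace ℝ (Fin 3)), Ψ (t + 1, y) = Ψ (t, y)) ∧
      InjOn Ψ (Ico (0 : ℝ) 1 ×ˢ ball (0 : EuclideanSpace ℝ (Fin 3)) ρ) ∧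
      (∀ t : ℝ, Ψ (t, 0) = e (circlePt t)) ∧
      (∀ (t : ℝ) (y : EuclideanSpace ℝ (Fin 3)), y ∈ ball (0 : EuclideanSpace ℝ (Fin 3)) ρ →
        (v : EuclideanSpace ℝ (Fin 3)) 2 * (f (Ψ (t, y)) : EuclideanSpace ℝ (Fin 3)) 2 =
          -(y 0) ^ 2 + (y 1) ^ 2 + (y 2) ^ 2) ∧
      ∀ (t : ℝ) (y : EuclideanSpace ℝ (Fin 3)),
        (f (Ψ (t, y)) : EuclideanSpace ℝ (Fin 3)) 0 =
            √((f (Ψ (t, y)) : EuclideanSpace ℝ (Fin 3)) 0 ^ 2 +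
                (f (Ψ (t, y)) : EuclideanSpace ℝ (Fin 3)) 1 ^ 2) * Real.cos (2 * π * t) ∧
          (f (Ψ (t, y)) : EuclideanSpace ℝ (Fin 3)) 1 =
            √((f (Ψ (t, y)) : EuclideanSpace ℝ (Fin 3)) 0 ^ 2 +
                (f (Ψ (t, y)) : EuclideanSpace ℝ (Fin 3)) 1 ^ 2) * Real.sin (2 * π * t) ∧
          0 < (f (Ψ (t, y)) : EuclideanSpace ℝ (Fin 3)) 0 ^ 2 +
            (f (Ψ (t, y)) : EuclideanSpace ℝ (Fin 3)) 1 ^ 2 := by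
  /- Step A: the lift `ν̃` and the family `g`. -/
  obtain ⟨νt, hνt⟩ : ∃ νt : ℝ × EuclideanSpace ℝ (Fin 3) → X,
      νt = fun q => ν.toFun (circlePt q.1, q.2) := ⟨_, rfl⟩
  have hνtM : ContMDiff (𝓘(ℝ, ℝ).prod 𝓘(ℝ, EuclideanSpace ℝ (Fin 3))) (𝓡 4) ∞ νt := by
    rw [hνt]
    exact ν.isSmoothEmbedding.contMDiff.comp (contMDiff_circlePt.prodMap contMDiff_id)
  have hgs : ContDiff ℝ ∞ g := by
    haveI : Fact (Module.finrank ℝ (EuclideanSpace ℝ (Fin 3)) = 2 + 1) :=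
      ⟨finrank_euclideanSpace_fin⟩
    have h1 : ContMDiff (𝓘(ℝ, ℝ).prod 𝓘(ℝ, EuclideanSpace ℝ (Fin 3)))
        𝓘(ℝ, EuclideanSpace ℝ (Fin 3)) ∞
        (fun q => (f (νt q) : EuclideanSpace ℝ (Fin 3))) :=
      (contMDiff_coe_sphere (n := 2) (E := EuclideanSpace ℝ (Fin 3))).comp
        (hf.contMDiff.comp hνtM)
    have h2 : ContDiff ℝ ∞ fun q => (f (νt q) : EuclideanSpace ℝ (Fin 3)) 2 :=
      contDiff_euclidean.1 (RoundTube.contDiff_of_contMDiff_prod h1) 2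
    have h3 : g = fun q => (v : EuclideanSpace ℝ (Fin 3)) 2 *
        (f (νt q) : EuclideanSpace ℝ (Fin 3)) 2 := by
      funext q; rw [hg, hνt]
    rw [h3]
    exact contDiff_const.mul h2
  have hgT : ∀ (t : ℝ) (u : EuclideanSpace ℝ (Fin 3)), g (t + 1, u) = g (t, u) := fun t u => by
    rw [hg, hg]
    simp only [circlePt_add_one]
  /- Step B: the transverse Hessian along the circle (`roundHessian`). -/
  have hRH := fun t => hf.roundHessian hround hv0 hv1 hlo hhi hrange hfe ν hg t
  have hg0 : ∀ t : ℝ, g (t, 0) = 0 := fun t => (hRH t).1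
  have h1' : ∀ (t : ℝ) (a : EuclideanSpace ℝ (Fin 3)), fderiv ℝ g (t, 0) ((0 : ℝ), a) = 0 :=
    fun t a => by rw [(hRH t).2.1]; rfl
  have hH : ∀ (t : ℝ) (a : EuclideanSpace ℝ (Fin 3)),
      (∀ b, fderiv ℝ (fderiv ℝ g) (t, 0) ((0 : ℝ), a) ((0 : ℝ), b) = 0) → a = 0 := by
    intro t a hab
    obtain ⟨M, γ, hγ, hM⟩ := (hRH t).2.2
    have key : ∀ b : EuclideanSpace ℝ (Fin 3),
        (M a) 0 * (M b) 0 + (M a) 1 * (M b) 1 - (M a) 2 * (M b) 2 = 0 := fun b => by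
      have := hab b
      rw [hM] at this
      exact (mul_eq_zero.1 this).resolve_left hγ.ne'
    have e0 := key (M.symm (EuclideanSpace.single (0 : Fin 3) (1 : ℝ)))
    have e1 := key (M.symm (EuclideanSpace.single (1 : Fin 3) (1 : ℝ)))
    have e2 := key (M.symm (EuclideanSpace.single (2 : Fin 3) (1 : ℝ)))
    simp only [ContinuousLinearEquiv.apply_symm_apply, PiLp.single_apply] at e0 e1 e2
    norm_num at e0 e1 e2
    have hMa : M a = 0 := by
      ext i
      fin_cases i
      · simpa using e0
      · simpa using e1
      · simpa using e2
    have := congrArg M.symm hMa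
    rwa [M.symm_apply_apply, map_zero] at this
  /- Step C: the reference form `B` at `t = 0` and its Lorentz frame. -/
  obtain ⟨M₀, γ₀, hγ₀, hM₀⟩ := (hRH 0).2.2
  obtain ⟨B, hB⟩ : ∃ B : EuclideanSpace ℝ (Fin 3) →L[ℝ] EuclideanSpace ℝ (Fin 3) →L[ℝ] ℝ,
      ∀ a b, B a b = (M₀ a) 0 * (M₀ b) 0 + (M₀ a) 1 * (M₀ b) 1 - (M₀ a) 2 * (M₀ b) 2 := by
    refine ⟨γ₀⁻¹ • (fderiv ℝ (fderiv ℝ g) ((0 : ℝ), (0 : EuclideanSpace ℝ (Fin 3)))).bilinearComp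
      (ContinuousLinearMap.inr ℝ ℝ (EuclideanSpace ℝ (Fin 3)))
      (ContinuousLinearMap.inr ℝ ℝ (EuclideanSpace ℝ (Fin 3))), fun a b => ?_⟩
    simp only [smul_apply, ContinuousLinearMap.bilinearComp_apply, ContinuousLinearMap.inr_apply,
      smul_eq_mul]
    rw [hM₀, ← mul_assoc, inv_mul_cancel₀ hγ₀.ne', one_mul]
  have hBsymm : ∀ a b, B a b = B b a := fun a b => by rw [hB, hB]; ring
  have hHB : ∀ a b : EuclideanSpace ℝ (Fin 3),
      fderiv ℝ (fderiv ℝ g) ((0 : ℝ), (0 : EuclideanSpace ℝ (Fin 3))) ((0 : ℝ), a) ((0 : ℝ), b) =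
        γ₀ * B a b := fun a b => by rw [hB, hM₀]
  have hMv₀ : M₀ (M₀.symm (EuclideanSpace.single (2 : Fin 3) (1 : ℝ))) =
      EuclideanSpace.single (2 : Fin 3) (1 : ℝ) := M₀.apply_symm_apply _
  have hMb₁ : M₀ (M₀.symm (EuclideanSpace.single (0 : Fin 3) (1 : ℝ))) =
      EuclideanSpace.single (0 : Fin 3) (1 : ℝ) := M₀.apply_symm_apply _
  have hMb₂ : M₀ (M₀.symm (EuclideanSpace.single (1 : Fin 3) (1 : ℝ))) =
      EuclideanSpace.single (1 : Fin 3) (1 : ℝ) := M₀.apply_symm_apply _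
  have hv : B (M₀.symm (EuclideanSpace.single (2 : Fin 3) (1 : ℝ)))
      (M₀.symm (EuclideanSpace.single (2 : Fin 3) (1 : ℝ))) = -1 := by
    rw [hB, hMv₀]; simp
  have h1 : B (M₀.symm (EuclideanSpace.single (0 : Fin 3) (1 : ℝ)))
      (M₀.symm (EuclideanSpace.single (0 : Fin 3) (1 : ℝ))) = 1 := by
    rw [hB, hMb₁]; simp
  have h2 : B (M₀.symm (EuclideanSpace.single (1 : Fin 3) (1 : ℝ)))
      (M₀.symm (EuclideanSpace.single (1 : Fin 3) (1 : ℝ))) = 1 := by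
    rw [hB, hMb₂]; simp
  have h01 : B (M₀.symm (EuclideanSpace.single (2 : Fin 3) (1 : ℝ)))
      (M₀.symm (EuclideanSpace.single (0 : Fin 3) (1 : ℝ))) = 0 := by
    rw [hB, hMv₀, hMb₁]; simp
  have h02 : B (M₀.symm (EuclideanSpace.single (2 : Fin 3) (1 : ℝ)))
      (M₀.symm (EuclideanSpace.single (1 : Fin 3) (1 : ℝ))) = 0 := by
    rw [hB, hMv₀, hMb₂]; simp
  have h12 : B (M₀.symm (EuclideanSpace.single (0 : Fin 3) (1 : ℝ)))
      (M₀.symm (EuclideanSpace.single (1 : Fin 3) (1 : ℝ))) = 0 := by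
    rw [hB, hMb₁, hMb₂]; simp
  have hexp : ∀ x : EuclideanSpace ℝ (Fin 3),
      x = (-B (M₀.symm (EuclideanSpace.single (2 : Fin 3) (1 : ℝ))) x) •
            M₀.symm (EuclideanSpace.single (2 : Fin 3) (1 : ℝ)) +
          B (M₀.symm (EuclideanSpace.single (0 : Fin 3) (1 : ℝ))) x •
            M₀.symm (EuclideanSpace.single (0 : Fin 3) (1 : ℝ)) +
          B (M₀.symm (EuclideanSpace.single (1 : Fin 3) (1 : ℝ))) x •
            M₀.symm (EuclideanSpace.single (1 : Fin 3) (1 : ℝ)) := by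
    intro x
    have e2 : B (M₀.symm (EuclideanSpace.single (2 : Fin 3) (1 : ℝ))) x = -(M₀ x) 2 := by
      rw [hB, hMv₀]; simp
    have e0 : B (M₀.symm (EuclideanSpace.single (0 : Fin 3) (1 : ℝ))) x = (M₀ x) 0 := by
      rw [hB, hMb₁]; simp
    have e1 : B (M₀.symm (EuclideanSpace.single (1 : Fin 3) (1 : ℝ))) x = (M₀ x) 1 := by
      rw [hB, hMb₂]; simp
    rw [e2, e0, e1, neg_neg]
    apply M₀.injective
    rw [map_add, map_add, map_smul, map_smul, map_smul, hMv₀, hMb₁, hMb₂]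
    ext i
    fin_cases i <;> simp
  /- Step D: periodic adapted frames (`FibrewiseMorseFramePeriodic`). -/
  obtain ⟨Fr, Frinv, hFrs, hFrinvs, hFrT, hFrinvT, hFF, hFF', hadapt⟩ :=
    Splitting.exists_periodic_adaptedFrame_of_timelike hgs one_pos hgT hH hBsymm hγ₀ hHB hv h1 h2
      h01 h02 h12 hexp hw hwT hwneg
  /- Step E: periodic fibrewise Morse coordinates (`FibrewiseMorseFrame`). -/
  obtain ⟨B₀, hB₀⟩ : ∃ B₀ : EuclideanSpace ℝ (Fin 3) →L[ℝ] EuclideanSpace ℝ (Fin 3) →L[ℝ] ℝ,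
      ∀ a b, B₀ a b = γ₀ / 2 * B a b :=
    ⟨(γ₀ / 2) • B, fun a b => by simp only [smul_apply, smul_eq_mul]⟩
  have hB₀symm : ∀ a b, B₀ a b = B₀ b a := fun a b => by rw [hB₀, hB₀, hBsymm]
  have hB₀nd : ∀ a, (∀ b, B₀ a b = 0) → a = 0 := by
    intro a hab
    refine hH 0 a fun b => ?_
    rw [hHB]
    have := hab b
    rw [hB₀] at this
    have hB0 : B a b = 0 := by
      rcases mul_eq_zero.1 this with h' | h'
      · exact absurd h' (by positivity)
      · exact h'
    rw [hB0, mul_zero]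
  have hn : finrank ℝ (EuclideanSpace ℝ (Fin 3)) = 3 := by simp
  have hadapt' : ∀ (t : ℝ) (a b : EuclideanSpace ℝ (Fin 3)),
      fderiv ℝ (fderiv ℝ g) (t, 0) ((0 : ℝ), a) ((0 : ℝ), b) = 2 * B₀ (Fr t a) (Fr t b) := by
    intro t a b
    rw [hadapt, hB₀]
    ring
  obtain ⟨r, y, Λ, hr, hys, hyT, hy0, hyd, -, hgy⟩ :=
    Splitting.exists_periodic_fibrewiseMorseCoords_of_frame hgs one_pos hgT hg0 h1' B₀ hB₀symm
      hB₀nd hn hFrs hFrinvs hFrT hFrinvT hFF hFF' hadapt'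
  /- Step F: the index of `B₀` is `1`, so `g = -y₀² + y₁² + y₂²`. -/
  have hsig : sigNeg ((B₀.toBilinForm).toQuadraticMap) = 1 := by
    classical
    have hval : ∀ i : Fin 3, B₀.toBilinForm (M₀.symm (EuclideanSpace.single i (1 : ℝ)))
        (M₀.symm (EuclideanSpace.single i (1 : ℝ))) = if i = 2 then -(γ₀ / 2) else γ₀ / 2 := by
      intro i
      rw [ContinuousLinearMap.toBilinForm_apply, hB₀, hB, M₀.apply_symm_apply]
      fin_cases i <;> simp
    have horth : Pairwise fun i j : Fin 3 =>
        B₀.toBilinForm (M₀.symm (EuclideanSpace.single i (1 : ℝ)))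
          (M₀.symm (EuclideanSpace.single j (1 : ℝ))) = 0 := by
      intro i j hij
      rw [ContinuousLinearMap.toBilinForm_apply, hB₀, hB, M₀.apply_symm_apply,
        M₀.apply_symm_apply]
      fin_cases i <;> fin_cases j <;> first | exact absurd rfl hij | simp
    have hp : ¬ γ₀ / 2 < 0 := not_lt.2 (by positivity)
    have hn' : -(γ₀ / 2) < 0 := by linarith
    have h0 : ∀ i : Fin 3, B₀.toBilinForm (M₀.symm (EuclideanSpace.single i (1 : ℝ)))
        (M₀.symm (EuclideanSpace.single i (1 : ℝ))) ≠ 0 := by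
      intro i
      rw [hval]
      split_ifs
      · exact hn'.ne
      · exact (half_pos hγ₀).ne'
    have hcard : Fintype.card (Fin 3) = finrank ℝ (EuclideanSpace ℝ (Fin 3)) := by simp
    obtain ⟨-, hneg⟩ := LinearMap.BilinForm.sigPos_eq_card_of_orthogonal B₀.toBilinForm
      (fun i : Fin 3 => M₀.symm (EuclideanSpace.single i (1 : ℝ))) horth h0 hcard
    rw [hneg, Fintype.card_subtype]
    have hfilt : (Finset.univ.filter fun i : Fin 3 =>
        B₀.toBilinForm (M₀.symm (EuclideanSpace.single i (1 : ℝ)))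
          (M₀.symm (EuclideanSpace.single i (1 : ℝ))) < 0) = {2} := by
      ext i
      simp only [Finset.mem_filter, Finset.mem_univ, true_and, Finset.mem_singleton, hval]
      constructor
      · intro hi
        by_contra hne
        rw [if_neg hne] at hi
        exact hp hi
      · intro hi
        rw [if_pos hi]
        exact hn'
    rw [hfilt, Finset.card_singleton]
  have hgy' : ∀ (t : ℝ) (u : EuclideanSpace ℝ (Fin 3)), u ∈ ball (0 : EuclideanSpace ℝ (Fin 3)) r →
      g (t, u) = -(y (t, u) 0) ^ 2 + (y (t, u) 1) ^ 2 + (y (t, u) 2) ^ 2 := by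
    intro t u hu
    rw [hgy t u hu, hsig]
    have hf1 : Finset.univ.filter (fun i : Fin 3 => i.val < 1) = {0} := by decide
    have hf2 : Finset.univ.filter (fun i : Fin 3 => 1 ≤ i.val) = {1, 2} := by decide
    rw [hf1, hf2, Finset.sum_singleton, Finset.sum_pair (by decide)]
    ring
  /- Step G: the fibred local inverse `x` of `y` (`FibredLocalInverse`). -/
  have hyd' : ∀ t : ℝ, ∃ D : EuclideanSpace ℝ (Fin 3) ≃L[ℝ] EuclideanSpace ℝ (Fin 3),
      HasFDerivAt (fun u : EuclideanSpace ℝ (Fin 3) => y (t, u))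
        (D : EuclideanSpace ℝ (Fin 3) →L[ℝ] EuclideanSpace ℝ (Fin 3)) 0 := by
    intro t
    let FrE : EuclideanSpace ℝ (Fin 3) ≃L[ℝ] EuclideanSpace ℝ (Fin 3) :=
      ContinuousLinearEquiv.equivOfInverse (Fr t) (Frinv t) (hFF' t) (hFF t)
    refine ⟨FrE.trans Λ, ?_⟩
    have he : ((FrE.trans Λ : EuclideanSpace ℝ (Fin 3) ≃L[ℝ] EuclideanSpace ℝ (Fin 3)) :
        EuclideanSpace ℝ (Fin 3) →L[ℝ] EuclideanSpace ℝ (Fin 3)) =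
        (Λ : EuclideanSpace ℝ (Fin 3) →L[ℝ] EuclideanSpace ℝ (Fin 3)).comp (Fr t) := by
      ext a : 1
      rfl
    rw [he]
    exact hyd t
  obtain ⟨ε, ρ, x, hε, hεr, hρ, hxs, hxT, hx0, hxy, hyinj⟩ :=
    Splitting.exists_fibred_localInverse hr one_pos hys hyT hy0 hyd'
  /- Step H: the tube `Ψ (t, w) = ν̃ (t, x (t, w))`. -/
  obtain ⟨Θ, hΘ⟩ : ∃ Θ : ℝ × EuclideanSpace ℝ (Fin 3) → ℝ × EuclideanSpace ℝ (Fin 3),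
      Θ = fun p => (p.1, x p) := ⟨_, rfl⟩
  obtain ⟨Ψ, hΨ⟩ : ∃ Ψ : ℝ × EuclideanSpace ℝ (Fin 3) → X, Ψ = νt ∘ Θ := ⟨_, rfl⟩
  have hΨ_apply : ∀ (t : ℝ) (w : EuclideanSpace ℝ (Fin 3)),
      Ψ (t, w) = ν.toFun (circlePt t, x (t, w)) := fun t w => by
    rw [hΨ, hΘ, hνt]; rfl
  have hUo : IsOpen ((univ : Set ℝ) ×ˢ ball (0 : EuclideanSpace ℝ (Fin 3)) ρ) :=
    isOpen_univ.prod isOpen_ball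
  have hmemU : ∀ {t : ℝ} {w : EuclideanSpace ℝ (Fin 3)},
      ((t, w) : ℝ × EuclideanSpace ℝ (Fin 3)) ∈ (univ : Set ℝ) ×ˢ
        ball (0 : EuclideanSpace ℝ (Fin 3)) ρ ↔ w ∈ ball (0 : EuclideanSpace ℝ (Fin 3)) ρ :=
    fun {t} {w} => by simp [mem_prod]
  have hΘs : ContDiffOn ℝ ∞ Θ ((univ : Set ℝ) ×ˢ ball (0 : EuclideanSpace ℝ (Fin 3)) ρ) := by
    rw [hΘ]; exact contDiffOn_fst.prodMk hxs
  have hΘM : ∀ q ∈ (univ : Set ℝ) ×ˢ ball (0 : EuclideanSpace ℝ (Fin 3)) ρ,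
      ContMDiffAt (𝓘(ℝ, ℝ).prod 𝓘(ℝ, EuclideanSpace ℝ (Fin 3)))
        (𝓘(ℝ, ℝ).prod 𝓘(ℝ, EuclideanSpace ℝ (Fin 3))) ∞ Θ q := fun q hq =>
    RoundTube.contMDiffAt_prod_prod_of_contDiffAt (hΘs.contDiffAt (hUo.mem_nhds hq))
  have hΨM : ContMDiffOn (𝓘(ℝ, ℝ).prod 𝓘(ℝ, EuclideanSpace ℝ (Fin 3))) (𝓡 4) ∞ Ψ
      ((univ : Set ℝ) ×ˢ ball (0 : EuclideanSpace ℝ (Fin 3)) ρ) := by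
    rw [hΨ]
    exact fun q hq => (hνtM.contMDiffAt.comp q (hΘM q hq)).contMDiffWithinAt
  -- the left inverse `Φ (t, u) = (t, y (t, u))` of `Θ` on the tube
  have hxr : ∀ (t : ℝ) (w : EuclideanSpace ℝ (Fin 3)), w ∈ ball (0 : EuclideanSpace ℝ (Fin 3)) ρ →
      x (t, w) ∈ ball (0 : EuclideanSpace ℝ (Fin 3)) r := fun t w hw =>
    ball_subset_ball hεr (hxy t w hw).1
  have hSo : IsOpen ((univ : Set ℝ) ×ˢ ball (0 : EuclideanSpace ℝ (Fin 3)) r) :=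
    isOpen_univ.prod isOpen_ball
  have hΘinj : ∀ q ∈ (univ : Set ℝ) ×ˢ ball (0 : EuclideanSpace ℝ (Fin 3)) ρ,
      Injective (mfderiv (𝓘(ℝ, ℝ).prod 𝓘(ℝ, EuclideanSpace ℝ (Fin 3)))
        (𝓘(ℝ, ℝ).prod 𝓘(ℝ, EuclideanSpace ℝ (Fin 3))) Θ q) := by
    rintro ⟨t, w⟩ hq
    have hw : w ∈ ball (0 : EuclideanSpace ℝ (Fin 3)) ρ := hmemU.1 hq
    obtain ⟨Φ, hΦ⟩ : ∃ Φ : ℝ × EuclideanSpace ℝ (Fin 3) → ℝ × EuclideanSpace ℝ (Fin 3),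
        Φ = fun p => (p.1, y p) := ⟨_, rfl⟩
    have hΘq : Θ (t, w) = (t, x (t, w)) := by rw [hΘ]
    have hΦs : ContDiffAt ℝ ∞ Φ (Θ (t, w)) := by
      rw [hΦ, hΘq]
      refine contDiffAt_fst.prodMk (hys.contDiffAt (hSo.mem_nhds ?_))
      simp [mem_prod, hxr t w hw]
    have hΦM : MDifferentiableAt (𝓘(ℝ, ℝ).prod 𝓘(ℝ, EuclideanSpace ℝ (Fin 3)))
        (𝓘(ℝ, ℝ).prod 𝓘(ℝ, EuclideanSpace ℝ (Fin 3))) Φ (Θ (t, w)) :=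
      (RoundTube.contMDiffAt_prod_prod_of_contDiffAt hΦs).mdifferentiableAt (by simp)
    have hΘd : MDifferentiableAt (𝓘(ℝ, ℝ).prod 𝓘(ℝ, EuclideanSpace ℝ (Fin 3)))
        (𝓘(ℝ, ℝ).prod 𝓘(ℝ, EuclideanSpace ℝ (Fin 3))) Θ (t, w) :=
      (hΘM _ hq).mdifferentiableAt (by simp)
    have hcomp := mfderiv_comp (t, w) hΦM hΘd
    have hev : (Φ ∘ Θ) =ᶠ[𝓝 ((t, w) : ℝ × EuclideanSpace ℝ (Fin 3))] id := by
      filter_upwards [hUo.mem_nhds hq] with p hp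
      obtain ⟨s, u⟩ := p
      show Φ (Θ (s, u)) = (s, u)
      rw [hΘ, hΦ]
      show (s, y (s, x (s, u))) = (s, u)
      rw [(hxy s u (hmemU.1 hp)).2]
    have hid : mfderiv (𝓘(ℝ, ℝ).prod 𝓘(ℝ, EuclideanSpace ℝ (Fin 3)))
        (𝓘(ℝ, ℝ).prod 𝓘(ℝ, EuclideanSpace ℝ (Fin 3))) (Φ ∘ Θ) (t, w) =
        mfderiv (𝓘(ℝ, ℝ).prod 𝓘(ℝ, EuclideanSpace ℝ (Fin 3)))
          (𝓘(ℝ, ℝ).prod 𝓘(ℝ, EuclideanSpace ℝ (Fin 3))) id (t, w) := hev.mfderiv_eq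
    rw [mfderiv_id, hcomp] at hid
    intro a b hab
    have h2 := congrArg (mfderiv (𝓘(ℝ, ℝ).prod 𝓘(ℝ, EuclideanSpace ℝ (Fin 3)))
      (𝓘(ℝ, ℝ).prod 𝓘(ℝ, EuclideanSpace ℝ (Fin 3))) Φ (Θ (t, w))) hab
    rw [← ContinuousLinearMap.comp_apply, ← ContinuousLinearMap.comp_apply, hid] at h2
    exact h2
  have hΨld : ∀ q ∈ (univ : Set ℝ) ×ˢ ball (0 : EuclideanSpace ℝ (Fin 3)) ρ,
      IsLocalDiffeomorphAt (𝓘(ℝ, ℝ).prod 𝓘(ℝ, EuclideanSpace ℝ (Fin 3))) (𝓡 4) ∞ Ψ q := by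
    intro q hq
    have hinj : Injective (mfderiv (𝓘(ℝ, ℝ).prod 𝓘(ℝ, EuclideanSpace ℝ (Fin 3))) (𝓡 4) Ψ q) := by
      have hcomp := mfderiv_comp q (hνtM.contMDiffAt.mdifferentiableAt (by simp))
        ((hΘM q hq).mdifferentiableAt (by simp))
      rw [hΨ, hcomp]
      have h1 := RoundTube.injective_mfderiv_lift ν (Θ q)
      rw [← hνt] at h1
      exact h1.comp (hΘinj q hq)
    let L₀ : (ℝ × EuclideanSpace ℝ (Fin 3)) →ₗ[ℝ] EuclideanSpace ℝ (Fin 4) :=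
      show (ℝ × EuclideanSpace ℝ (Fin 3)) →ₗ[ℝ] EuclideanSpace ℝ (Fin 4) from
        (mfderiv (𝓘(ℝ, ℝ).prod 𝓘(ℝ, EuclideanSpace ℝ (Fin 3))) (𝓡 4) Ψ q).toLinearMap
    have hinj' : Injective L₀ := hinj
    have hsurj : Surjective L₀ :=
      (LinearMap.injective_iff_surjective_of_finrank_eq_finrank (by simp)).1 hinj'
    let L : (ℝ × EuclideanSpace ℝ (Fin 3)) ≃L[ℝ] EuclideanSpace ℝ (Fin 4) :=
      (LinearEquiv.ofBijective L₀ ⟨hinj', hsurj⟩).toContinuousLinearEquiv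
    exact isLocalDiffeomorphAt_of_mfderiv hUo hq hΨM (by simp) L (by ext v; rfl)
  /- Step I: collect. -/
  refine ⟨Ψ, ρ, hρ, hΨM, hΨld, fun t w => ?_, ?_, fun t => ?_, fun t w hw => ?_, fun t w => ?_⟩
  · -- periodicity
    rw [hΨ_apply, hΨ_apply, hxT, circlePt_add_one]
  · -- injectivity on a fundamental domain
    rintro ⟨t, w⟩ ⟨ht, hw⟩ ⟨t', w'⟩ ⟨ht', hw'⟩ heq
    rw [hΨ_apply, hΨ_apply] at heq
    have h1 := ν.isSmoothEmbedding.isEmbedding.injective heq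
    obtain ⟨h2, h3⟩ := Prod.mk.inj h1
    have h4 : t = t' := circlePt_injOn_Ico ht ht' h2
    subst h4
    have h5 : y (t, x (t, w)) = y (t, x (t, w')) := by rw [h3]
    rw [(hxy t w hw).2, (hxy t w' hw').2] at h5
    rw [h5]
  · -- zero section
    rw [hΨ_apply, hx0, ν.apply_zero]
  · -- the quadratic form
    rw [hΨ_apply]
    have h1 := hgy' t (x (t, w)) (hxr t w hw)
    rw [hg] at h1
    dsimp only at h1
    rw [h1, (hxy t w hw).2]
  · -- the longitude
    rw [hΨ_apply]
    have h1 := hlong (circlePt t) (x (t, w))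
    rwa [circlePt_apply_zero, circlePt_apply_one] at h1

end IsSimplifiedBrokenLefschetzFibration

end Literature.Topology.FourManifolds
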